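import Literature.AnabelianGeometry.EtaleTheta.FrdIVocabulary
import Literature.AnabelianGeometry.EtaleTheta.Discharge.Sec5Prop51Example39

/-!
# [EtTh] §5 discharge: Proposition 5.1 at the Example 3.9 (iv) Frobenioid — the "non-dilating" clause DERIVED
# at the canonical monoid vocabulary

Mochizuki, *The étale theta function and its Frobenioid-theoretic manifestations*, Publ. RIMS **45** (2009),
Prop. 5.1 p. 323 (PDF p. 97) [cite: MochizukiEtTh2009, Prop 5.1 p.323 (PDF p.97)]: "The Frobenioid `C` is a tempered
Frobenioid of rationally standard type over a slim base category `D`, whose monoid type is `ℤ`, and whose divisor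
monoid `Φ(−)` is perfect, perf-factorial, non-dilating, and cuspidally pure. In particular, `C` and the
self-equivalence `Ψ : C ⥲ C` satisfy all of the hypotheses of Corollary 3.8, (i), (ii), (iii); Theorem 4.4", stated
in print as following "from Example 3.9, (iv)"; Example 3.9 (iii) p. 84 (PDF p. 310): "`Φ_W^ell` is a perfect and
group-saturated submonoid of … `Φ_W` …, perf-factorial, non-dilating, and cuspidally pure", and (iv) p. 85
(PDF p. 311): "`Φ_α^ell := Φ_W^ell|_{D_α}`".  abc-iut cell, block C (W6 cone prover abc-iut-w6-d062), node EtTh:Prop5.1;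
PROOF-ONLY companion (no `def`) of abc-iut-L2-t4's `FrobenioidThetaBiKummer.lean` (`ApplicabilityOfGeneralTheory`,
FACT-LIST F-2496), abc-iut-L2-t3's `ThetaFrobenioid.lean` (`Example39Data`) and abc-iut-L2-t9's
`ThetaFrobenioidOfTempered.lean` / `Discharge/Sec5Prop51Example39.lean` (`applicability_of_model` /
`applicability_of_example39`).  Nothing landed is edited or restated.

WHAT IS PROVED.
* `Example39Data.isNonDilating_Φα` — Example 3.9 (iv): `Φ_α^ell = Φ_W^ell|_{D_α}` inherits "non-dilating" from
  `Φ_W^ell` objectwise (the datum's field `isNonDilating`, in the datum's monoid vocabulary `V`), exactly as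
  `isPerfect_Φα` / `isPerfFactorial_Φα` inherit "perfect" / "perf-factorial";
* `Example39Data.isNonDilatingOn_thetaFrobenioid` — at the CANONICAL monoid vocabulary `V = treeMonoidVocab`
  ("non-dilating" = the tree's [FrdI] Def. 1.1 (i) `Frobenioids.IsNonDilating`, `FrdIVocabulary.lean`), the divisor
  monoid of the tempered Frobenioid `E.thetaFrobenioid α h` of Example 3.9 (iv) is non-dilating in the tree's
  functorial sense `Frobenioids.IsNonDilatingOn` ([FrdI] Def. 1.1 (ii)) — the INPUT `hnd` of
  `applicability_of_example39` (its docstring: "non-dilating (found's `IsNonDilatingOn`; Example 3.9 (iii) records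
  non-dilation in abc-iut-L2-t3's vocabulary `V`, not bridged here)") is now a theorem;
* `Example39Data.applicability_of_example39_treeMonoidVocab` (and the `∀ 𝔉 Ψ` packaging `…_all`) — Proposition 5.1
  for §5 data over the Example 3.9 (iv) Frobenioid at `V = treeMonoidVocab`, REDUCED TO: the three vocabulary
  parameters of `VocabParams` ("rationally standard type", the hypothesis packages of Cor. 3.8 / Thm. 4.4 — plan/L2
  MERGE-PLAN row 3), `D_W` slim ([SemiAnbd] slimness of `B^temp(W^log)⁰`, Rmk. 3.7.2, by name), the monoid type `Λ = ℤ`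
  of the §3 data, and the named fact `Example39_iv_cuspidallyPure` (F-0615); "tempered", "perfect", "perf-factorial",
  "slim base `D_α`" (given `D_W` slim) and now "non-dilating" are DISCHARGED.

HONEST FRAMING: a reduction over abc-iut-L2-t3's DATA structure `Example39Data` and abc-iut-L2-t4's §5 DATA; nothing
asserts these data exist for an actual curve; [EtTh] is refereed and nothing here bears on [IUTchIII] Cor. 3.12 — no
side is taken; typed ≠ proved.
-/

namespace Literature.AnabelianGeometry.EtaleTheta

open CategoryTheory Opposite Literature.AlgebraicGeometry.Frobenioids FrobenioidTheta TemperedFrobenioid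

universe u v w

namespace Example39Data

/-! ### Example 3.9 (iv): `Φ_α^ell` is non-dilating (inherited from `Φ_W^ell`), any monoid vocabulary -/

section AnyVocab

variable {V : FrdIMonoidStub.{w}} {DW : Type u} [Category.{v} DW] {TW : RealifiedDivisorMonoids (D₀ := DW) V}
  (E : Example39Data V DW TW) {A B : DW} (α : A ⟶ B)

/-- **Example 3.9 (iv)** (p. 85 (PDF p. 311)): `Φ_α^ell := Φ_W^ell|_{D_α}` is "non-dilating" — inherited objectwise
from Example 3.9 (iii)'s "`Φ_W^ell` is … non-dilating" (the datum's field `isNonDilating`, stated in the datum's monoid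
vocabulary `V` on the pull-backs along endomorphisms): an endomorphism `f` of an object `X` of `D_α` gives (via
`D_α → D_W`) an endomorphism of the underlying object of `D_W`, and `Φ_α^ell(X) = Φ_W^ell(X|_{D_W})` with the same
pull-back map.  [cite: MochizukiEtTh2009, Ex 3.9 p.85 (PDF p.311)] -/
theorem isNonDilating_Φα (X : (Dα α)ᵒᵖ) (f : X ⟶ X) :
    V.IsNonDilating ((E.Φα α).carrier X) ((E.Φα α).pull f) :=
  E.isNonDilating ((toDW α).op.obj X) ((toDW α).op.map f)

end AnyVocab

/-! ### Proposition 5.1 for the Example 3.9 (iv) Frobenioid at `treeMonoidVocab`: "non-dilating" discharged -/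

section TreeMonoidVocab

variable {DW : Type u} [Category.{v} DW] {TW : RealifiedDivisorMonoids (D₀ := DW) treeMonoidVocab.{w}}
  (E : Example39Data treeMonoidVocab.{w} DW TW) {A B : DW} (α : A ⟶ B)

/-- **The "non-dilating" clause of Proposition 5.1 for the Example 3.9 (iv) Frobenioid, DERIVED** (canonical monoid
vocabulary `treeMonoidVocab`, where "non-dilating" IS the tree's [FrdI] Def. 1.1 (i) `Frobenioids.IsNonDilating`): the
divisor monoid `Φ_α^ell` of the tempered Frobenioid `E.thetaFrobenioid α h` is non-dilating in the functorial sense of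
[FrdI] Def. 1.1 (ii) (`Frobenioids.IsNonDilatingOn`: every pull-back along an endomorphism of an object of `D_α` is
non-dilating) — by `isNonDilating_Φα`.  This is the input `hnd` of abc-iut-L2-t9's `applicability_of_example39`.
[cite: MochizukiEtTh2009, Prop 5.1 p.323 (PDF p.97)] -/
theorem isNonDilatingOn_thetaFrobenioid {VD : FrdICatStub.{max u v, v, w} (Dα α)} (h : E.FrobenioidHyp α VD) :
    IsNonDilatingOn (E.thetaFrobenioid α h).divisorMonoid :=
  fun X f => E.isNonDilating_Φα α (op X) f.op

/-- **Proposition 5.1 for the tempered Frobenioid `C₀` of Example 3.9 (iv) at the canonical monoid vocabulary, reduced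
to its inputs — "non-dilating" now DISCHARGED.**  For §5 data `𝔉` whose Frobenioid-level part is that of
`C₀ = E.thetaFrobenioid α h` (`h𝔉`), abc-iut-L2-t4's `ApplicabilityOfGeneralTheory 𝔉 (thetaVocab 𝔉 P) Ψ` holds as soon
as: the three vocabulary parameters hold ("rationally standard type" `hrs`, the hypothesis packages of Cor. 3.8 `h38`
and Thm. 4.4 `h44` — [FrdI] Def. 4.5 (iii) / abc-iut-L2-t3's `Cor38Hyp`, `Thm44Hyp`, plan/L2 MERGE-PLAN row 3), `D_W`
is slim (`hW`; Rmk. 3.7.2), the §3 data have monoid type `ℤ` (`hZ`), and `Φ_α^ell` is cuspidally pure (`hcp` = the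
named fact `Example39_iv_cuspidallyPure`, F-0615).  "Tempered" (by construction), "perfect" (Example 3.9 (iii),
`isPerfect_Φα`), "perf-factorial" (Def. 3.6 (ii)), "slim base `D_α`" (`isSlim_Dα` from `hW`) and "non-dilating"
(`isNonDilatingOn_thetaFrobenioid`) are theorems.  [cite: MochizukiEtTh2009, Prop 5.1 p.323 (PDF p.97)] -/
theorem applicability_of_example39_treeMonoidVocab {VD : FrdICatStub.{max u v, v, w} (Dα α)}
    (h : E.FrobenioidHyp α VD)
    (𝔉 : ThetaFrobenioid.{w} (E.thetaFrobenioid α h).category (Dα α))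
    (P : (E.thetaFrobenioid α h).VocabParams)
    {hΦ : ∀ X : (Dα α)ᵒᵖ, IsIntegral ((E.thetaFrobenioid α h).Φ.carrier X)}
    {IsBFT : MorphismProperty (E.thetaFrobenioid α h).category}
    (h𝔉 : 𝔉.toTemperedFrobenioidStub = (E.thetaFrobenioid α h).thetaStub hΦ IsBFT)
    (Ψ : (E.thetaFrobenioid α h).category ≌ (E.thetaFrobenioid α h).category)
    (hrs : P.IsRationallyStandard) (hW : IsSlim DW) (hZ : TW.Λ = MonoidType.Z)
    (hcp : E.Example39_iv_cuspidallyPure α h) (h38 : P.HypothesesCor38 Ψ) (h44 : P.HypothesesThm44 Ψ) :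
    FrobenioidThetaBiKummer.ApplicabilityOfGeneralTheory 𝔉 (thetaVocab 𝔉 P) Ψ :=
  E.applicability_of_example39 α h 𝔉 P h𝔉 Ψ hrs hW hZ (E.isNonDilatingOn_thetaFrobenioid α h) hcp h38 h44

/-- The residual of `applicability_of_example39_treeMonoidVocab` packaged as ONE hypothesis list, for the node census:
Prop. 5.1 at the Example 3.9 (iv) Frobenioid holds for EVERY §5 datum over it and EVERY self-equivalence `Ψ` as soon
as the six named inputs hold (three vocabulary parameters, `D_W` slim, `Λ = ℤ`, cuspidal purity).
[cite: MochizukiEtTh2009, Prop 5.1 p.323 (PDF p.97)] -/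
theorem applicability_of_example39_treeMonoidVocab_all {VD : FrdICatStub.{max u v, v, w} (Dα α)}
    (h : E.FrobenioidHyp α VD) (hW : IsSlim DW) (hZ : TW.Λ = MonoidType.Z)
    (hcp : E.Example39_iv_cuspidallyPure α h)
    (P : (E.thetaFrobenioid α h).VocabParams) (hrs : P.IsRationallyStandard)
    (h38 : ∀ Ψ, P.HypothesesCor38 Ψ) (h44 : ∀ Ψ, P.HypothesesThm44 Ψ)
    (𝔉 : ThetaFrobenioid.{w} (E.thetaFrobenioid α h).category (Dα α))
    {hΦ : ∀ X : (Dα α)ᵒᵖ, IsIntegral ((E.thetaFrobenioid α h).Φ.carrier X)}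
    {IsBFT : MorphismProperty (E.thetaFrobenioid α h).category}
    (h𝔉 : 𝔉.toTemperedFrobenioidStub = (E.thetaFrobenioid α h).thetaStub hΦ IsBFT)
    (Ψ : (E.thetaFrobenioid α h).category ≌ (E.thetaFrobenioid α h).category) :
    FrobenioidThetaBiKummer.ApplicabilityOfGeneralTheory 𝔉 (thetaVocab 𝔉 P) Ψ :=
  E.applicability_of_example39_treeMonoidVocab α h 𝔉 P h𝔉 Ψ hrs hW hZ hcp (h38 Ψ) (h44 Ψ)

end TreeMonoidVocab

end Example39Data

end Literature.AnabelianGeometry.EtaleTheta
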